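import Mathlib
import HarnessLib
import HarnessLib.Audit
import Summits.AtomisticToContinuum.Statement

/-!
Route: PolystickyAlphabet

CLOSED (retired) 2026-08-15T13:45:45Z by operator:999:1257524 — reason: not-a-thesis: assembly does not conclude the sub-problem Statement — note: D-0027 §2.1 audit (human 2026-08-15: routes that do not decide the summit are removed): the assembly concludes `RadialNonAttainment`, not the sub-problem statement; a NEW conforming route may be opened from the same idea (generated `closes : … → _root_.Crystallization`).. The file is kept as the record of this route; refuted decls are indexed as negative knowledge (`ledger negatives`).

# Route PolystickyAlphabet — polysticky particles need not crystallize — a distance alphabet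
emulating an aperiodic tile set gives a one-species radial finite-range V whose periodic infimum is
approached, never attained

BARRIER ROUTE (D-0021 negative knowledge), realising card radial-aperiodicity-seat (regimes (B)+(C)
merged; regime (A) dropped, see Not decomposed yet). It is declared up front that X does NOT imply
Summit.AtomisticToContinuum.Crystallization and is not claimed to: X fills the residual seat of the
barrier catalogue (Literature.Barriers.AtomisticToContinuum.AperiodicTilingGroundStates,
scope_caveats: "ONE species of POINT particles, RADIAL pair potential" is untouched by every
aperiodic-ground-state construction) for the summit's OWN energetic predicate, in d = 2 (Theil's
dimension) and d = 3 (the summit's). X = RadialNonAttainment: in each of d = 2, 3 there is a pair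
potential V : ℝ → ℝ (radial by the tree's formalisation), finite range, bounded below, with finite-N
ground states for every N, such that E(N)/N → e < 0, e is the infimum of the energy per particle
over periodic configurations (lattice + finite motif), and NO periodic configuration attains e — so
`HasPeriodicGroundStateEnergy V d` fails exactly by non-attainment (the conjunct-(i) pathology),
with existence, stability and convergence all intact. The witness is a POLYSTICKY potential V = +P
on (0,R) ∖ D, −w on a finite distance alphabet D, 0 beyond R (the Heitmann–Radin sticky disc is ¦D¦
= 1; Bétermin–De Luca–Petrache's square-lattice potential is the two-well case): X1 =
AlphabetAperiodicity2D/3D (a distance alphabet whose score-maximal ("perfect") admissible point sets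
exist only aperiodically while periodic admissible sets come ε-close on average — proved by
emulating an aperiodic Wang tile set, Berger's theorem being PROVED in the tree, with generically
decorated one-species molecules) and X2 = PolystickyReduction (frustration-free energy accounting
without a hard core turns X1 into the target).
Lean: `(∃ V : ℝ → ℝ, (∃ R₀ : ℝ, ∀ r, R₀ ≤ r → V r = 0) ∧ (∃ c : ℝ, ∀ r, c ≤ V r) ∧ (∀ N : ℕ, ∃ x :
Fin N → EuclideanSpace ℝ (Fin 2), Literature.MathematicalPhysics.StatisticalMechanics.IsGroundState
V x) ∧ ∃ e : ℝ, e < 0 ∧ Tendsto (fun N : ℕ =>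
Literature.MathematicalPhysics.StatisticalMechanics.groundStateEnergy V 2 N / N) atTop (𝓝 e) ∧ IsGLB
(Set.range fun Q : Literature.MathematicalPhysics.StatisticalMechanics.PeriodicConfiguration 2 =>
Q.energyPerParticle V) e ∧ (∀ Q :
Literature.MathematicalPhysics.StatisticalMechanics.PeriodicConfiguration 2, e < Q.energyPerParticle
V) ∧ ¬ Literature.MathematicalPhysics.StatisticalMechanics.HasPeriodicGroundStateEnergy V 2) ∧ (∃ V
: ℝ → ℝ, (∃ R₀ : ℝ, ∀ r, R₀ ≤ r → V r = 0) ∧ (∃ c : ℝ, ∀ r, c ≤ V r) ∧ (∀ N : ℕ, ∃ x : Fin N →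
EuclideanSpace ℝ (Fin 3), Literature.MathematicalPhysics.StatisticalMechanics.IsGroundState V x) ∧ ∃
e : ℝ, e < 0 ∧ Tendsto (fun N : ℕ =>
Literature.MathematicalPhysics.StatisticalMechanics.groundStateEnergy V 3 N / N) atTop (𝓝 e) ∧ IsGLB
(Set.range fun Q : Literature.MathematicalPhysics.StatisticalMechanics.PeriodicConfiguration 3 =>
Q.energyPerParticle V) e ∧ (∀ Q :
Literature.MathematicalPhysics.StatisticalMechanics.PeriodicConfiguration 3, e < Q.energyPerParticle
V) ∧ ¬ Literature.MathematicalPhysics.StatisticalMechanics.HasPeriodicGroundStateEnergy V 3)`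

## Assembly
Pure logic (proved sorry-free in the folder's Sketch.lean, `assembly_holds`, axioms
propext/choice/Quot.sound): AlphabetAperiodicity2D and AlphabetAperiodicity3D supply alphabets in d
= 2, 3; PolystickyReduction at d = 2 (0 < 2) and d = 3 turns each into the corresponding conjunct of
RadialNonAttainment. The conclusion is the barrier statement RadialNonAttainment, NOT the summit:
this is a barrier route (precedent: AnomalousDissipation/TaylorResolutionBarrier); its deliverable
is a Theorems file a literature seat can vendor as
Literature/Barriers/AtomisticToContinuum/RadialAperiodicGroundStates, closing the catalogue's
scope_caveats line, and a calibration of RefuteCrystalPeriodicMin's non-attainment logic on a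
potential where it is true.

Rationale: WHY THIS LINE. The catalogue's audit (AperiodicTilingGroundStates, evasions (a)–(e)) shows forced
aperiodicity survives uniqueness, isotropy beyond range one ON THE LATTICE (Radin1986LatticeGas,
Miekisz1997 §4), several species in the continuum (Radin1986Continuum; BlancLewin2015 §3.2) and one
species of rigid bodies (SmithMyersKaplanGoodmanStrauss2024), and names one species of point
particles with a radial potential as the only untouched class; every live Crystallization route
assumes, without proof, that this class needs Lennard-Jones-specific numbers. The mechanism imported
here is Radin's tiling dictionary (Radin1991 §2d; tree: Berger1966_aperiodicTileset_holds via
Kari1996) made SUBSTRATE-FREE: forbidding every distance below R outside a finite alphabet D makes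
admissible configurations uniformly discrete with a finite atlas of local stars (the role the
lattice plays in Radin1986LatticeGas and the hard disc plays in HeitmannRadin1980), and a GENERIC
decoration of each Wang tile by n₀ identical atoms makes distance data determine tile type, relative
placement and chirality (generic global rigidity / Cayley–Menger, imported from rigidity theory), so
that maximal rewarded coordination = legal matching on all four sides. The energy side is the
frustration-free bookkeeping of sticky-disc proofs (HeitmannRadin1980, BeterminDelucaPetrache2021)
plus a charging lemma replacing the hard core (V is real-valued in the tree). What the line does
that prior work does not: Sütő's and the sticky sphere's aperiodic ground states (Suto2006; tree
AperiodicKissingTwelvePackings) COEXIST with periodic minimisers, Radin's continuum model uses two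
species, his isotropic model lives on ℤ²; here one species, radial, continuum, and the periodic
infimum is provably NOT attained — the first instance where the tree's predicate
HasPeriodicGroundStateEnergy fails for an LJ-type (core + wells + zero tail) radial potential,
calibrating route RefuteCrystalPeriodicMin's logic on a case where non-attainment is true.

RANKED CRUXES. #0 RadialNonAttainment (target) — for d = 2 and for d = 3: there is V : ℝ → ℝ of
finite range, bounded below, with a ground state for every N, and e < 0 with E(N)/N → e, e = inf of
energyPerParticle over PeriodicConfiguration d (IsGLB), e < energyPerParticle Q for every periodic
Q, hence ¬HasPeriodicGroundStateEnergy V d. (why it might fail: only through the cruxes: if no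
distance alphabet forces aperiodic order (AlphabetAperiodicity false in d = 2 and 3), polysticky
potentials always have periodic minimisers and the seat must be attacked with smooth designed tails
instead.) [BlancLewin2015, Radin1991, Radin1986Continuum, HeitmannRadin1980]
#2 AlphabetAperiodicity2D (crux) — (card S4/S3, planar rung; the spine) there are a finite alphabet
D ⊂ (0,R) and rewards w ≥ 0 supported on {s ∈ D : 2s < R}, w ≢ 0, such that, with adm X ⇔ all
distances < R between distinct points of X ⊂ ℝ² lie in D, score X x = Σ' over y ∈ X∖{x} of w(dist x
y), M = sup of scores over admissible (X, x): (b) no admissible PERIODIC configuration is perfect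
(some point of Q.points has score ≠ M), and (c) for every ε > 0 some admissible periodic Q has
average score over its motif ≥ M − ε. Intended proof: decorate each tile of an aperiodic Wang set
(Berger1966_aperiodicTileset_holds, Kari's 14 tiles, in tree; or JeandelRao2021's 11) by n₀ ≥ 3
atoms at algebraically independent positions near the cell centre; D = all distances < R of the
decorated FULL shift, w = 1 on intra-molecule and LEGAL edge-adjacency distances (all < R/2);
generic clique rigidity (every admissible set of points pairwise closer than R is congruent to a
sub-configuration of a decorated full-shift configuration or its mirror) gives M = 5n₀ − 1 with
equality exactly at atoms whose cell has four legal neighbours, so perfect ⇒ decorated legal tiling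
⇒ non-periodic; legal n×n patches repeated periodically are admissible with average score ≥ M −
16n₀/n. [difficulty: L] (why it might fail: unintended admissible cliques: Cayley–Menger identities
holding identically among translate-related decoration distances (offset cycles that do not close in
ℤ²), or interpenetrating enantiomeric copies, could let a periodic parasite reach score M; then
weights/penalties must be redesigned.) [Radin1991, Kari1996, JeandelRao2021, Radin1986LatticeGas,
HeitmannRadin1980, BeterminDelucaPetrache2021]
#3 PolystickyReduction (crux) — (card S3, the energy side, every dimension d ≥ 1) for every alphabet
(D, R, w) as above satisfying (b) and (c) in ℝ^d there is a penalty P such that the polysticky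
potential V_P r = (if r ∈ D then −w r else if 0 < r < R then P else 0) has: finite range, a lower
bound, ground states for every N, E(N)/N → −M/2 =: e < 0, e = IsGLB of the periodic energies per
particle, e < e(Q) for every periodic Q, and ¬HasPeriodicGroundStateEnergy V_P d. Proof plan: lower
bound from PolystickyChargingBound (good atoms form an admissible set, each scores ≤ M; incidences
at bad atoms are charged to forbidden pairs); upper bounds from blocks of the approximants of (c)
(boundary loss O(N^{(d−1)/d})); strictness: a periodic Q with e(Q) = e has zero forbidden-pair
density, hence is admissible with all scores = M, contradicting (b); ground states exist since V_P
takes three values. [difficulty: M] (why it might fail: V is real-valued (no hard core): if piled-up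
bad atoms could sit on unboundedly many reward spheres without a proportional number of forbidden
pairs, the sharp lower bound −(M/2)N fails and e < −M/2, after which (b),(c) no longer decide
attainment.) [HeitmannRadin1980, BeterminDelucaPetrache2021, BlancLewin2015, Theil2006]
#4 AlphabetAperiodicity3D (crux) — (the summit's dimension; the catalogue's literal seat "one
species, radial, d = 3") the same as AlphabetAperiodicity2D for point sets in ℝ³ and
PeriodicConfiguration 3. Intended proof: Wang CUBES obtained from an aperiodic planar Wang set by
forcing identical vertical copies (top colour = bottom colour = tile name), so legal ℤ³-tilings are
(planar aperiodic tiling) × ℤ and admit no rank-3 period lattice; generic decoration of cubes and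
the same clique-rigidity argument (3k − 6 degrees of freedom against k(k−1)/2 typed distances).
[deps: AlphabetAperiodicity2D] [difficulty: L] (why it might fail: admissible cliques in ℝ³ have
more freedom (3k − 6 dof), decorated columns are only screw/stacking-rigid, and a periodic parasite
reaching score M would need a genuinely three-dimensional rigid aperiodic template (Culik–Kari
cubes, SCD-type) instead.) [Radin1991, Kari1996, BlancLewin2015, SmithMyersKaplanGoodmanStrauss2024]
#9 FiniteValuedGroundStates (support) — a pair potential taking finitely many values has a finite-N
ground state for every N in every dimension d ≥ 1 (the interaction energy ranges over a finite set,
so the infimum over injective configurations is attained); discharges the existence clause of the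
target for polysticky potentials (three values). [difficulty: provable-now] [BlancLewin2015]
#9 PolystickyChargingBound (support) — for every alphabet (D, R, w) as above in ℝ^d: the score set
of admissible configurations is bounded above (uniform discreteness: distances < R lie in D ⊂
(0,R)), its supremum M is positive, and there is P₀ such that for P ≥ P₀ every injective
configuration of N points has polysticky energy ≥ −(M/2)·N. Proof: atoms with no forbidden partner
("good") form an admissible set, so each scores ≤ M among good atoms; reward incidences involving a
bad atom number ≤ C·(#forbidden pairs) by a cube-partition count (cubes of side < min D/√d hold
pairwise-forbidden atoms), so rewards ≤ (M/2)N + C'·F ≤ (M/2)N + P·F. [difficulty: M]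
[HeitmannRadin1980, BeterminDelucaPetrache2021]

TWO-LAYER PLAN. Foreseen glued splits (k ≤ 3, depth 1), filed only after a crux closes or stalls
with a census: AlphabetAperiodicity2D ⇐ GenericCliqueRigidity2D (admissible cliques of a generically
decorated full shift are intended, up to isometry) → PerfectImpliesLegal2D (score M only at atoms
with four legal adjacencies; local-to-global) → AlphabetAperiodicity2D (with
Berger1966_aperiodicTileset_holds and the n×n approximants as glue); AlphabetAperiodicity3D likewise
with the stacked Wang cubes; PolystickyReduction ⇐ PolystickyChargingBound (already filed as
support) → PeriodicEnergyAccounting (e(Q) = −½·average score + P·forbidden density for finite-range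
V, strict deficit under (b)) → PolystickyReduction.

KILL CRITERIA. A proof that EVERY planar alphabet with property (c) admits a perfect periodic
admissible set (¬AlphabetAperiodicity2D — itself a striking positive "radial local rules
crystallize" theorem, the continuum analogue of the catalogue's range-one evasion
exists_isPeriodic_isPairGroundStateConfig_of_symmetric) closes the route
`refuted:AlphabetAperiodicity2D` and retires regime (B) of the card in the sticky idealisation; the
seat then belongs to smooth designed tails (card aperiodic-by-design-radial-polytypes).
¬AlphabetAperiodicity3D alone ⇒ pivot: restate the target to d = 2 only (drop the second conjunct).
¬PolystickyReduction can only come from the no-hard-core bookkeeping ⇒ pivot: restate with an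
explicit hard-core convention (P = P(N) or admissible-only ground states), not a close. A
one-species radial continuum construction found in print (Radin1986Continuum turning out to be
one-species, acq-00482) makes the route `known` ⇒ close superseded by a cite item.

NOT DECOMPOSED YET. The clique-rigidity lemma and the local-to-global step (layer-2 children above);
the explicit alphabet size (¦D¦ ~ 10⁴ for Kari's 14 tiles with n₀ = 3) and any MINIMAL-alphabet
question (is ¦D¦ = 2 or 3 possible? conjecturally two wells always crystallize in d = 2, cf.
BeterminDelucaPetrache2021); robustness under wells of positive width (the
FlexibleKissingArrangements regime — not claimed); ¬IsCrystallizing for the same V (not claimed: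
Blanc–Lewin's existential translations can centre on periodic scars of size N^(1/4), which the
energy cannot exclude); regime (A) of the card (stealthy class never aperiodic-only at zero
pressure: re-posed by refuters as the extremal stealth-density problem ρ_min(κ) = lattice-packing
density of the dual, an LP/Cohn–Elkies dual statement, sharp only where the LP bound is — a
different thesis, not filed here); the undecidability corollary (card S5, false as written per
refuter-12; the defensible form "attainment is undecidable over rational polysticky alphabets" would
follow from a uniform version of the emulation and is left out).

CHEAPEST FALSIFIER. (1) Computation (one kit job, not run in this plancard seat): take Kari's 14
tiles (tree) or Jeandel–Rao's 11, n₀ = 3 random high-precision decoration points per tile, list the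
typed distances < R of the full shift, and enumerate 4- and 5-cliques of typed distances realisable
in the plane (Cayley–Menger determinant vanishing to working precision, then exact algebraic check):
any UNINTENDED realisable clique that extends to a star of score ≥ 5n₀ − 1 kills the intended proof
of AlphabetAperiodicity2D (not the statement). (2) Lookup: read Radin1986Continuum (CMP 105,
paywalled, acq-00482): if its continuum model is in fact ONE species with a radial potential, the
route is `known`. (3) For PolystickyReduction: the two-line check that k atoms piled in a ball of
radius < min D contribute ≥ k(k−1)/2 forbidden pairs while gaining ≤ k·K(D,R) rewards — done by hand
above, consistent.

NUMBERS. Heitmann–Radin: ¦D¦ = 1 (sticky disc, d = 2) ⇒ ground states ⊂ triangular lattice, E(N) =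
−⌊3N − √(12N − 3)⌋ (HeitmannRadin1980); two wells {1, √2} with Bétermin–De Luca–Petrache's shape
conditions ⇒ square lattice (BeterminDelucaPetrache2021); smallest aperiodic Wang set: 11 tiles, 4
colours (JeandelRao2021); Kari's set in the tree: 14 tiles (Kari1996); intended maximal score M =
5n₀ − 1 (= 14 for n₀ = 3), approximant deficit ≤ 16n₀/n per atom for period n; degrees of freedom:
planar k-cliques 2k − 3 vs k(k−1)/2 typed distances (overdetermined from k = 4), spatial 3k − 6
(from k = 5). Items at open: 7 (target, 3 cruxes, 2 support, assembly).

DEFINITION REQUESTS. None blocking: all statements elaborate over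
Literature.MathematicalPhysics.StatisticalMechanics (interactionEnergy, groundStateEnergy,
IsGroundState, PeriodicConfiguration, energyPerParticle, HasPeriodicGroundStateEnergy) and Mathlib.
Optional convenience (to be filed after open): notions `Polysticky.Admissible / score / maxScore /
potential` under Summits/AtomisticToContinuum/Crystallization/Theorems so that later restatements
are short. Cite-only acquisition: acq-00482 (Radin1986Continuum).

Novelty: Searches (2026-08-15; local searchd down, OpenAlex 429, galaxy queued > 90 s — remote legs used):
`lit search --source crossref "Radin crystals and quasicrystals continuum model"` (8:
doi:10.1007/bf01205933, doi:10.1016/0375-9601(86)90720-6 found and cited); `--source crossref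
"nonperiodic ground states identical particles isotropic pair potential continuum"` (8, none
relevant); `--source crossref "aperiodic ground state two-body radial potential plane rigorous"` (7,
none); `--source crossref "quasicrystal ground state Lennard-Jones Gauss proof"` (8: Engel–Trebin
2008 Phil. Mag., simulation); `--source crossref "crystallization square lattice two-body potential
Betermin De Luca Petrache"` (doi:10.1007/s00205-021-01627-6); `--source crossref "ground state
sticky disks Heitmann Radin"` (doi:10.1007/bf01014644, De Luca–Novaga–Ponsiglione 2018,
Friedrich–Kreutz–Schmidt 2021); `--source crossref "local rules quasicrystal interatomic distances
Delone set"` (Danzer–Dolbilin 1997, Dolbilin 2025 — regularity criteria, no energy); `--source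
crossref "aperiodic tilings ground states pair potentials identical particles matching rules
decoration"` (Fletcher 2010 low-complexity atlas monotile; no potentials); `--source zbmath
"aperiodic ground state pair potential"` (0), `"nonperiodic ground state continuum particles"` (0);
`lit read arxiv:1504.01153 --grep Radin` (BlancLewin2015 p.19: Radin-86 = two species,
quasi-periodic minimisers); the card's two refuter sweeps (R7, refuter-12: no rig  [refs: 10.1007/bf01205933, 10.1016/0375-9601(86, 10.1007/s00205-021-01627-6, 10.1007/bf01014644, 10.1007/bf01205933:, 1504.01153, doi:10.1007/bf01205933, doi:10.1016/0375-9601, doi:10.1007/s00205-021-01627-6, doi:10.1007/bf01014644, arxiv:1504.01153, BlancLewin2015, HeitmannRadin1980, BeterminDelucaPetrache2021, Suto2006, Berger1966, Kari1996]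

Barriers (technique_class: barrier-construction, distance-alphabet, sft-emulation): - technique_class: barrier-construction, distance-alphabet, sft-emulation
- Literature.Barriers.AtomisticToContinuum.AperiodicTilingGroundStates: not evaded but EXTENDED —
the route moves its recorded frontier (scope_caveats: one species, point particles, radial, d = 3)
by a construction and uses its engine (Berger1966_aperiodicTileset_holds, proved) inside
AlphabetAperiodicity; it inherits the barrier's lesson that forced aperiodicity is compatible with
existence of ground states and with E(N)/N converging.
- Literature.Barriers.AtomisticToContinuum.SutoDegenerateGroundStates: contrasted — Sütő's aperiodic
GSCs are degenerate companions of lattices that DO attain the minimum (and at zero pressure only the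
threshold lattice competes, SutoDegenerateGroundStatesNarrow); here no periodic configuration
attains the infimum; no Fourier positivity is used (V_P has a repulsive plateau and isolated wells,
V̂ changes sign).
- Literature.Barriers.AtomisticToContinuum.Hubbard1978_mostHomogeneous: the 1-D irrational-density
mechanism needs an imposed density/chemical potential; the polysticky construction is zero-pressure
with no imposed parameter, in d = 2, 3, and its aperiodicity comes from local rules (SFT emulation),
not from devil's staircases — so the two negative-side cards (this and
aperiodic-by-design-radial-polytypes, which transplants Hubbard through Barlow stackings) share no
crux.
- Literature.Barriers.AtomisticToContinuum.KissingTwelveDegeneracy: not met and sharpened — Aper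

History (route lifecycle, newest last):
- 2026-08-15T13:45:45Z · CLOSED retired — not-a-thesis: assembly does not conclude the sub-problem Statement (operator:999:1257524)

sub-problem: Crystallization · status: closed(retired) · opened planner-plancard-AtomisticToContinuum-Crystal-422c82ba-0 2026-08-15T11:41:30Z · rev 0 · ledger route-AtomisticToContinuum-PolystickyAlphabet
GENERATED by the gate from the ledger (D-0016/17). Provers cite these decls: `theorem foo : Summit.AtomisticToContinuum.Crystallization.Theses.PolystickyAlphabet.<Decl> := …` in Summits/AtomisticToContinuum/Crystallization/Theorems/<Name>.lean.
-/

namespace Summit.AtomisticToContinuum.Crystallization.Theses.PolystickyAlphabet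

open scoped BigOperators Topology Manifold Classical MeasureTheory ProbabilityTheory Matrix InnerProductSpace ComplexConjugate ContinuousMap
open Filter Set Function TopologicalSpace MeasureTheory

attribute [summit_statement] _root_.Crystallization

/-- item stmt-AtomisticToContinuum-5543 · target · rank 0 · closed · moot by None · by planner
why it might fail: only through the cruxes: if no distance alphabet forces aperiodic order (AlphabetAperiodicity false in d = 2 and 3), polysticky potentials always have periodic minimisers and the seat must be attacked with smooth designed tails instead.
sources: BlancLewin2015, Radin1991, Radin1986Continuum, HeitmannRadin1980
[target] for d = 2 and for d = 3: there is V : ℝ → ℝ of finite range, bounded below, with a ground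
state for every N, and e < 0 with E(N)/N → e, e = inf of energyPerParticle over
PeriodicConfiguration d (IsGLB), e < energyPerParticle Q for every periodic Q, hence
¬HasPeriodicGroundStateEnergy V d. -/
@[route_item "route-AtomisticToContinuum-PolystickyAlphabet"]
def RadialNonAttainment : Prop :=
  (∃ V : ℝ → ℝ, (∃ R₀ : ℝ, ∀ r, R₀ ≤ r → V r = 0) ∧ (∃ c : ℝ, ∀ r, c ≤ V r) ∧ (∀ N : ℕ, ∃ x : Fin N → EuclideanSpace ℝ (Fin 2), Literature.MathematicalPhysics.StatisticalMechanics.IsGroundState V x) ∧ ∃ e : ℝ, e < 0 ∧ Tendsto (fun N : ℕ => Literature.MathematicalPhysics.StatisticalMechanics.groundStateEnergy V 2 N / N) atTop (𝓝 e) ∧ IsGLB (Set.range fun Q : Literature.MathematicalPhysics.StatisticalMechanics.PeriodicConfiguration 2 => Q.energyPerParticle V) e ∧ (∀ Q : Literature.MathematicalPhysics.StatisticalMechanics.PeriodicConfiguration 2, e < Q.energyPerParticle V) ∧ ¬ Literature.MathematicalPhysics.StatisticalMechanics.HasPeriodicGroundStateEnergy V 2) ∧ (∃ V : ℝ → ℝ,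 (∃ R₀ : ℝ, ∀ r, R₀ ≤ r → V r = 0) ∧ (∃ c : ℝ, ∀ r, c ≤ V r) ∧ (∀ N : ℕ, ∃ x : Fin N → EuclideanSpace ℝ (Fin 3), Literature.MathematicalPhysics.StatisticalMechanics.IsGroundState V x) ∧ ∃ e : ℝ, e < 0 ∧ Tendsto (fun N : ℕ => Literature.MathematicalPhysics.StatisticalMechanics.groundStateEnergy V 3 N / N) atTop (𝓝 e) ∧ IsGLB (Set.range fun Q : Literature.MathematicalPhysics.StatisticalMechanics.PeriodicConfiguration 3 => Q.energyPerParticle V) e ∧ (∀ Q : Literature.MathematicalPhysics.StatisticalMechanics.PeriodicConfiguration 3, e < Q.energyPerParticle V) ∧ ¬ Literature.MathematicalPhysics.StatisticalMechanics.HasPeriodicGroundStateEnergy V 3)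

/-- item stmt-AtomisticToContinuum-5544 · crux · rank 2 · closed · moot by None · by planner
why it might fail: unintended admissible cliques: Cayley–Menger identities holding identically among translate-related decoration distances (offset cycles that do not close in ℤ²), or interpenetrating enantiomeric copies, could let a periodic parasite reach score M; then weights/penalties must be redesigned.
sources: Radin1991, Kari1996, JeandelRao2021, Radin1986LatticeGas, HeitmannRadin1980, BeterminDelucaPetrache2021
[crux] (card S4/S3, planar rung; the spine) there are a finite alphabet D ⊂ (0,R) and rewards w ≥ 0
supported on {s ∈ D : 2s < R}, w ≢ 0, such that, with adm X ⇔ all distances < R between distinct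
points of X ⊂ ℝ² lie in D, score X x = Σ' over y ∈ X∖{x} of w(dist x y), M = sup of scores over
admissible (X, x): (b) no admissible PERIODIC configuration is perfect (some point of Q.points has
score ≠ M), and (c) for every ε > 0 some admissible periodic Q has average score over its motif ≥ M
− ε. Intended proof: decorate each tile of an aperiodic Wang set (Berger1966_aperiodicTileset_holds,
Kari's 14 tiles, in tree; or JeandelRao2021's 11) by n₀ ≥ 3 atoms at algebraically independent
positions near the cell centre; D = all distances < R of the decorated FULL shift, w = 1 on
intra-molecule and LEGAL edge-adjacency distances (all < R/2); generic clique rigidity (every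
admissible set of points pairwise closer than R is congruent to a sub-configuration of a decorated
full-shift configuration or its mirror) gives M = 5n₀ − 1 with equality exactly at atoms whose cell
has four legal neighbours, so perfect ⇒ decorated legal tiling ⇒ non-periodic; legal n×n patches
repeated periodically are admi -/
@[route_item "route-AtomisticToContinuum-PolystickyAlphabet"]
def AlphabetAperiodicity2D : Prop :=
  ∃ (D : Finset ℝ) (R : ℝ) (w : ℝ → ℝ), ((∀ s ∈ D, 0 < s ∧ s < R) ∧ (∀ s, 0 ≤ w s) ∧ (∀ s, w s ≠ 0 → s ∈ D ∧ 2 * s < R) ∧ (∃ s, 0 < w s)) ∧ let adm : Set (EuclideanSpace ℝ (Fin 2)) → Prop := fun X => ∀ x ∈ X, ∀ y ∈ X, x ≠ y → dist x y < R → dist x y ∈ D; let score : Set (EuclideanSpace ℝ (Fin 2)) → EuclideanSpace ℝ (Fin 2) → ℝ := fun X x => ∑' y : {y : EuclideanSpace ℝ (Fin 2) // y ∈ X ∧ y ≠ x}, w (dist x y.1); let M : ℝ := sSup {s : ℝ | ∃ X, adm X ∧ ∃ x ∈ X, s = score X x}; (∀ Q : Literature.MathematicalPhysics.StatisticalMechanics.PeriodicConfiguration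 2, adm Q.points → ∃ x ∈ Q.points, score Q.points x ≠ M) ∧ (∀ ε : ℝ, 0 < ε → ∃ Q : Literature.MathematicalPhysics.StatisticalMechanics.PeriodicConfiguration 2, adm Q.points ∧ M - ε ≤ (Q.motif.card : ℝ)⁻¹ * ∑ x ∈ Q.motif, score Q.points x)

/-- item stmt-AtomisticToContinuum-5545 · crux · rank 3 · closed · moot by None · by planner
why it might fail: V is real-valued (no hard core): if piled-up bad atoms could sit on unboundedly many reward spheres without a proportional number of forbidden pairs, the sharp lower bound −(M/2)N fails and e < −M/2, after which (b),(c) no longer decide attainment.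
sources: HeitmannRadin1980, BeterminDelucaPetrache2021, BlancLewin2015, Theil2006
[crux] (card S3, the energy side, every dimension d ≥ 1) for every alphabet (D, R, w) as above
satisfying (b) and (c) in ℝ^d there is a penalty P such that the polysticky potential V_P r = (if r
∈ D then −w r else if 0 < r < R then P else 0) has: finite range, a lower bound, ground states for
every N, E(N)/N → −M/2 =: e < 0, e = IsGLB of the periodic energies per particle, e < e(Q) for every
periodic Q, and ¬HasPeriodicGroundStateEnergy V_P d. Proof plan: lower bound from
PolystickyChargingBound (good atoms form an admissible set, each scores ≤ M; incidences at bad atoms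
are charged to forbidden pairs); upper bounds from blocks of the approximants of (c) (boundary loss
O(N^{(d−1)/d})); strictness: a periodic Q with e(Q) = e has zero forbidden-pair density, hence is
admissible with all scores = M, contradicting (b); ground states exist since V_P takes three values.
[difficulty: M] -/
@[route_item "route-AtomisticToContinuum-PolystickyAlphabet"]
def PolystickyReduction : Prop :=
  ∀ (d : ℕ), 0 < d → ∀ (D : Finset ℝ) (R : ℝ) (w : ℝ → ℝ), ((∀ s ∈ D, 0 < s ∧ s < R) ∧ (∀ s, 0 ≤ w s) ∧ (∀ s, w s ≠ 0 → s ∈ D ∧ 2 * s < R) ∧ (∃ s, 0 < w s)) → let adm : Set (EuclideanSpace ℝ (Fin d)) → Prop := fun X => ∀ x ∈ X, ∀ y ∈ X, x ≠ y → dist x y < R → dist x y ∈ D; let score : Set (EuclideanSpace ℝ (Fin d)) → EuclideanSpace ℝ (Fin d) → ℝ := fun X x => ∑' y : {y : EuclideanSpace ℝ (Fin d) // y ∈ X ∧ y ≠ x}, w (dist x y.1); let M : ℝ := sSup {s : ℝ | ∃ X, adm X ∧ ∃ x ∈ X, s = score X x}; (∀ Q : Literature.MathematicalPhysics.StatisticalMechanics.PeriodicConfiguration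 d, adm Q.points → ∃ x ∈ Q.points, score Q.points x ≠ M) → (∀ ε : ℝ, 0 < ε → ∃ Q : Literature.MathematicalPhysics.StatisticalMechanics.PeriodicConfiguration d, adm Q.points ∧ M - ε ≤ (Q.motif.card : ℝ)⁻¹ * ∑ x ∈ Q.motif, score Q.points x) → ∃ P : ℝ, let V : ℝ → ℝ := fun r => if r ∈ D then - w r else if 0 < r ∧ r < R then P else 0; (∃ R₀ : ℝ, ∀ r, R₀ ≤ r → V r = 0) ∧ (∃ c : ℝ, ∀ r, c ≤ V r) ∧ (∀ N : ℕ, ∃ x : Fin N → EuclideanSpace ℝ (Fin d), Literature.MathematicalPhysics.StatisticalMechanics.IsGroundState V x) ∧ ∃ e : ℝ, e < 0 ∧ Tendsto (fun N : ℕ => Literature.MathematicalPhysics.StatisticalMechanics.groundStateEnergy V d N / N) atTop (𝓝 e) ∧ IsGLB (Set.range fun Q : Literature.MathematicalPhysics.StatisticalMechanics.PeriodicConfiguration d => Q.energyPerParticle V) e ∧ (∀ Q : Literature.MathematicalPhysics.StatisticalMechanics.PeriodicConfiguration d, e < Q.energyPerParticle V) ∧ ¬ Literature.MathematicalPhysics.StatisticalMechanics.HasPeriodicGroundStateEnergy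 V d

/-- item stmt-AtomisticToContinuum-5546 · crux · rank 4 · closed · moot by None · by planner
why it might fail: admissible cliques in ℝ³ have more freedom (3k − 6 dof), decorated columns are only screw/stacking-rigid, and a periodic parasite reaching score M would need a genuinely three-dimensional rigid aperiodic template (Culik–Kari cubes, SCD-type) instead.
sources: Radin1991, Kari1996, BlancLewin2015, SmithMyersKaplanGoodmanStrauss2024
[crux] (the summit's dimension; the catalogue's literal seat "one species, radial, d = 3") the same
as AlphabetAperiodicity2D for point sets in ℝ³ and PeriodicConfiguration 3. Intended proof: Wang
CUBES obtained from an aperiodic planar Wang set by forcing identical vertical copies (top colour =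
bottom colour = tile name), so legal ℤ³-tilings are (planar aperiodic tiling) × ℤ and admit no
rank-3 period lattice; generic decoration of cubes and the same clique-rigidity argument (3k − 6
degrees of freedom against k(k−1)/2 typed distances). [deps: AlphabetAperiodicity2D] [difficulty: L] -/
@[route_item "route-AtomisticToContinuum-PolystickyAlphabet"]
def AlphabetAperiodicity3D : Prop :=
  ∃ (D : Finset ℝ) (R : ℝ) (w : ℝ → ℝ), ((∀ s ∈ D, 0 < s ∧ s < R) ∧ (∀ s, 0 ≤ w s) ∧ (∀ s, w s ≠ 0 → s ∈ D ∧ 2 * s < R) ∧ (∃ s, 0 < w s)) ∧ let adm : Set (EuclideanSpace ℝ (Fin 3)) → Prop := fun X => ∀ x ∈ X, ∀ y ∈ X, x ≠ y → dist x y < R → dist x y ∈ D; let score : Set (EuclideanSpace ℝ (Fin 3)) → EuclideanSpace ℝ (Fin 3) → ℝ := fun X x => ∑' y : {y : EuclideanSpace ℝ (Fin 3) // y ∈ X ∧ y ≠ x}, w (dist x y.1); let M : ℝ := sSup {s : ℝ | ∃ X, adm X ∧ ∃ x ∈ X, s = score X x}; (∀ Q : Literature.MathematicalPhysics.StatisticalMechanics.PeriodicConfiguration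 3, adm Q.points → ∃ x ∈ Q.points, score Q.points x ≠ M) ∧ (∀ ε : ℝ, 0 < ε → ∃ Q : Literature.MathematicalPhysics.StatisticalMechanics.PeriodicConfiguration 3, adm Q.points ∧ M - ε ≤ (Q.motif.card : ℝ)⁻¹ * ∑ x ∈ Q.motif, score Q.points x)

/-- item stmt-AtomisticToContinuum-5547 · support · rank 9 · closed · moot by None · by planner
sources: BlancLewin2015
[support] a pair potential taking finitely many values has a finite-N ground state for every N in
every dimension d ≥ 1 (the interaction energy ranges over a finite set, so the infimum over
injective configurations is attained); discharges the existence clause of the target for polysticky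
potentials (three values). [difficulty: provable-now] -/
@[route_item "route-AtomisticToContinuum-PolystickyAlphabet"]
def FiniteValuedGroundStates : Prop :=
  ∀ (V : ℝ → ℝ), (Set.range V).Finite → ∀ (d N : ℕ), 0 < d → ∃ x : Fin N → EuclideanSpace ℝ (Fin d), Literature.MathematicalPhysics.StatisticalMechanics.IsGroundState V x

/-- item stmt-AtomisticToContinuum-5548 · support · rank 9 · closed · moot by None · by planner
sources: HeitmannRadin1980, BeterminDelucaPetrache2021
[support] for every alphabet (D, R, w) as above in ℝ^d: the score set of admissible configurations
is bounded above (uniform discreteness: distances < R lie in D ⊂ (0,R)), its supremum M is positive,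
and there is P₀ such that for P ≥ P₀ every injective configuration of N points has polysticky energy
≥ −(M/2)·N. Proof: atoms with no forbidden partner ("good") form an admissible set, so each scores ≤
M among good atoms; reward incidences involving a bad atom number ≤ C·(#forbidden pairs) by a
cube-partition count (cubes of side < min D/√d hold pairwise-forbidden atoms), so rewards ≤ (M/2)N +
C'·F ≤ (M/2)N + P·F. [difficulty: M] -/
@[route_item "route-AtomisticToContinuum-PolystickyAlphabet"]
def PolystickyChargingBound : Prop :=
  ∀ (d : ℕ), 0 < d → ∀ (D : Finset ℝ) (R : ℝ) (w : ℝ → ℝ), ((∀ s ∈ D, 0 < s ∧ s < R) ∧ (∀ s, 0 ≤ w s) ∧ (∀ s, w s ≠ 0 → s ∈ D ∧ 2 * s < R) ∧ (∃ s, 0 < w s)) → let adm : Set (EuclideanSpace ℝ (Fin d)) → Prop := fun X => ∀ x ∈ X, ∀ y ∈ X, x ≠ y → dist x y < R → dist x y ∈ D; let score : Set (EuclideanSpace ℝ (Fin d)) → EuclideanSpace ℝ (Fin d) → ℝ := fun X x => ∑' y : {y : EuclideanSpace ℝ (Fin d) // y ∈ X ∧ y ≠ x}, w (dist x y.1); let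 S : Set ℝ := {s : ℝ | ∃ X, adm X ∧ ∃ x ∈ X, s = score X x}; BddAbove S ∧ 0 < sSup S ∧ ∃ P₀ : ℝ, ∀ P : ℝ, P₀ ≤ P → ∀ (N : ℕ) (x : Fin N → EuclideanSpace ℝ (Fin d)), Function.Injective x → -(sSup S / 2) * N ≤ Literature.MathematicalPhysics.StatisticalMechanics.interactionEnergy (fun r => if r ∈ D then - w r else if 0 < r ∧ r < R then P else 0) x

/-- item stmt-AtomisticToContinuum-5549 · assembly · rank 1 · closed · moot by None · by planner
sources: Radin1991, BlancLewin2015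
[assembly] AlphabetAperiodicity2D → AlphabetAperiodicity3D → PolystickyReduction →
RadialNonAttainment. -/
@[route_item "route-AtomisticToContinuum-PolystickyAlphabet"]
def Assembly : Prop :=
  AlphabetAperiodicity2D → AlphabetAperiodicity3D → PolystickyReduction → RadialNonAttainment

end Summit.AtomisticToContinuum.Crystallization.Theses.PolystickyAlphabet
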